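import Summits.ABC.IUTFork.Joshi.ArithmeticoidsInequivalent

/-!
# [J-2½] Thm. 5.5.2 (7) with `V^arc` ARBITRARY (possibly infinite): `LocalTopInequivalent` + archimedean/non-archimedean
# SEPARATION ⟹ `Thm552_7` — the `V^arc`-infinite complement of p440813 (arXiv:2305.10398 §5.5)

Block E proof-only companion (cell abc-iut, rung LADDER-ABC:A2.E; seat abc-iut-E-t38, consumer lineage of `DeformationDatum.Thm552_7`;
coordinated with the row's author lineage E-t37, STATUS 2026-08-26 11:22Z). Conventions and source as in `ArithmeticoidsInequivalent`
p440813 ([J-2½] = K. Joshi, arXiv:2305.10398, bib `Joshi2023ATS2half`; «p.N l.M» = render line). TAKES NO SIDE on [IUTchIII] Cor. 3.12 or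
on any author; typed ≠ proved; nothing asserted (0 defs).

p440813 `thm552_7_of_localTopInequivalent` derives Thm. 5.5.2 (7) (p.34 l.28) from print's ground `LocalTopInequivalent` (p.35 l.23–30)
under «`V^arc` FINITE» + «a non-archimedean place»; the model `TwoTop.hotel` (p443036) shows «`V^arc` finite» cannot simply be dropped.
THIS FILE gives the variant that survives an INFINITE `V^arc`: replace finiteness by the SEPARATION clause «no residue field at an
archimedean place is homeomorphically isomorphic to one at a non-archimedean place» — true in print's setting for a reason independent
of counting (archimedean untilts are `(ℂ, |−|^θ_ℂ)`, p.12 l.21–22 / Prop. 2.4.3 p.12 l.33–36: connected; non-archimedean untilts are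
totally disconnected) and violated by the hotel. PROOF: choose at EVERY place a point whose residue field is not in the class of
`K_{y⁰,v₀}` (`v₀` non-archimedean; at non-archimedean places one member of the [Kedlaya–Temkin] pair, at archimedean places `y⁰_v` by
separation); then `K_{y⁰,v₀}` is matched nowhere and p437051 `thm552_7_of_unmatched` concludes. Also: an inequivalent pair at EVERY
place (archimedean included) suffices with no clause at all (`thm552_7_of_forall_pair`).
-/

noncomputable section

namespace Summit.ABC.IUTFork.Joshi.ATS2h

namespace DeformationDatum

variable {L : Type} [Field L] {V : Type} {Lv : V → Type} [∀ v, Field (Lv v)] {Y : V → Type}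
  [∀ v, TopologicalSpace (Y v)] {K : (v : V) → Y v → Type} [∀ v y, Field (K v y)] [∀ v y, TopologicalSpace (K v y)]
  {G : V → Type} [∀ v, Group (G v)] {A : V → Type} [∀ v, Group (A v)]
  (D : DeformationDatum L V Lv Y K G A)

omit [∀ v, TopologicalSpace (Y v)] in
/-- A topologically inequivalent pair `K_{v,a} ≄ K_{v,b}` at a place `v` lets one AVOID any class at `v`: for every residue field
`K_{w,z}` one of `a`, `b` has residue field not homeomorphically isomorphic to it (p440813 `TopFieldIso.symm/trans`). [folklore] -/
theorem exists_not_iso_of_pair {v : V} {a b : Y v} (hab : ¬ ∃ e : K v a ≃+* K v b, Continuous e ∧ Continuous e.symm)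
    {w : V} (z : Y w) : ∃ x : Y v, ¬ ∃ f : K w z ≃+* K v x, Continuous f ∧ Continuous f.symm := by
  by_cases ha : ∃ f : K w z ≃+* K v a, Continuous f ∧ Continuous f.symm
  · exact ⟨b, fun hb => hab (TopFieldIso.trans (TopFieldIso.symm ha) hb)⟩
  · exact ⟨a, ha⟩

/-- **p437051's unmatched triple from `LocalTopInequivalent` + SEPARATION, `V^arc` arbitrary**: with `v₀ ∈ V^non`, the base point
`y⁰ = D.pt0` (proof of Thm. 5.5.2 (6), p.35 l.17–18) and an arithmeticoid `y₂` chosen to avoid the class of `K_{y⁰,v₀}` at every place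
satisfy «`K_{y⁰,v₀}` is homeomorphically isomorphic to no `K_{y₂,w}`». [claim: Joshi2023ATS2half, status: disputed] -/
theorem exists_unmatched_of_separated (hloc : D.LocalTopInequivalent)
    (hsep : ∀ v, v ∈ D.Varc → ∀ (z : Y v) (w : V), w ∉ D.Varc → ∀ z' : Y w,
      ¬ ∃ f : K w z' ≃+* K v z, Continuous f ∧ Continuous f.symm)
    (v₀ : V) (hv₀ : v₀ ∉ D.Varc) :
    ∃ (y₁ y₂ : D.Arith) (v : V), ∀ w, ¬ ∃ f : K v (y₁ v) ≃+* K w (y₂ w), Continuous f ∧ Continuous f.symm := by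
  have key : ∀ w, ∃ x : Y w, ¬ ∃ f : K v₀ (D.pt0 v₀) ≃+* K w x, Continuous f ∧ Continuous f.symm := by
    intro w
    by_cases hw : w ∈ D.Varc
    · exact ⟨D.pt0 w, hsep w hw (D.pt0 w) v₀ hv₀ (D.pt0 v₀)⟩
    · obtain ⟨a, b, hab⟩ := hloc w hw
      exact exists_not_iso_of_pair hab (D.pt0 v₀)
  choose y₂ hy₂ using key
  exact ⟨fun v => D.pt0 v, y₂, v₀, hy₂⟩

/-- **[J-2½] Thm. 5.5.2 (7) (p.34 l.28), `V^arc` arbitrary**: `LocalTopInequivalent` (p.35 l.23–30) + the archimedean/non-archimedean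
separation clause + one non-archimedean place ⟹ `Thm552_7` (via p437051 `thm552_7_of_unmatched`). Complements p440813
`thm552_7_of_localTopInequivalent` («`V^arc` finite» instead of separation); the hotel model p443036 violates both and (7) fails there.
[claim: Joshi2023ATS2half, status: disputed] -/
theorem thm552_7_of_localTopInequivalent_of_separated (hloc : D.LocalTopInequivalent)
    (hsep : ∀ v, v ∈ D.Varc → ∀ (z : Y v) (w : V), w ∉ D.Varc → ∀ z' : Y w,
      ¬ ∃ f : K w z' ≃+* K v z, Continuous f ∧ Continuous f.symm)
    {v₀ : V} (hv₀ : v₀ ∉ D.Varc) : D.Thm552_7 :=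
  D.thm552_7_of_unmatched (D.exists_unmatched_of_separated hloc hsep v₀ hv₀)

/-- **A topologically inequivalent pair at EVERY place ⟹ (7)**, `V^arc` arbitrary and no clause: avoid the class of `K_{y⁰,v₀}`
everywhere with the pairs. (In print the archimedean places carry one topological residue field `ℂ`, Prop. 2.4.3, so there this
hypothesis fails and separation is what is used.) [claim: Joshi2023ATS2half, status: disputed] -/
theorem thm552_7_of_forall_pair (h : ∀ v, ∃ a b : Y v, ¬ ∃ e : K v a ≃+* K v b, Continuous e ∧ Continuous e.symm)
    (v₀ : V) : D.Thm552_7 := by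
  have key : ∀ w, ∃ x : Y w, ¬ ∃ f : K v₀ (D.pt0 v₀) ≃+* K w x, Continuous f ∧ Continuous f.symm := fun w => by
    obtain ⟨a, b, hab⟩ := h w
    exact exists_not_iso_of_pair hab (D.pt0 v₀)
  choose y₂ hy₂ using key
  exact D.thm552_7_of_unmatched ⟨fun v => D.pt0 v, y₂, v₀, hy₂⟩

end DeformationDatum

end Summit.ABC.IUTFork.Joshi.ATS2h
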